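import Summits.Parity.BatemanHorn.Theorems.RoughParitySectorsOddSectorShareLinearOneFormShare
import Literature.NumberTheory.Sieve.MaynardSieveLevel
import Literature.NumberTheory.Sieve.SmoothRoughDecomposition
import HarnessLib

/-!
# Route `RoughParitySectors`, crux `OddSectorShareLinear` (stmt-Parity-15629), line `birth`:
# helpers IV for the stub `stub_sieveDecouplingOdd_of_roughCellsBV` — from the rough-cell Bombieri–Vinogradov hypothesis to the divisor-weighted remainder bound

`--supports stmt-Parity-15629`.  The remainder sum of the odd decoupling sieve (S'b) is
`∑_{d ∣ P(z), d ≤ D} S^{ω(d)} E(αd)`, where `E(q)` must bound the discrepancy of the odd `z`-rough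
numbers `≤ y = αx + β` in every reduced class modulo `q`.  The hypothesis of the stub (the
registered stub `stub_roughCellsBV`) bounds, for each cell `Ω = j + 1` and ONE reduced class `c(q)`
per modulus, `∑_{q ≤ y^{1/4}} |disc_j(q, c(q))|` by `C y/(log y)^A`.  This file bridges the two:

* `card_Icc_filter_modEq_le`, `abs_cell_disc_le` — the trivial bound `|disc_j(q, a)| ≤ 4y/φ(q)`
  (`q ≤ y`);
* `exists_worst_class` — for each modulus a reduced class maximising a `q`-periodic function;
* `abs_odd_disc_le_sum` — the odd cell is the disjoint union of the cells `Ω = j + 1`, `j < J`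
  even, once `Ω ≤ J` on the rough numbers (`OneFormShare.card_filter_odd_eq_sum`), so the odd
  discrepancy is at most the sum of the cell discrepancies;
* `exists_majorant` — hence a majorant `E(q) = ∑_{j < J even} |disc_j(q, c_j(q))|` with
  `E(q) ≤ 4Jy/φ(q)` and `∑_{q ≤ Q} E(q) ≤ J C y/(log y)^A`;
* `sum_pow_omega_mul_le` — Cauchy–Schwarz (as in `MaynardPrimesHaveLevel.isBigO_sum_pow_omega_mul`):
  `∑_{q ≤ Q} K^{ω(q)} E(q) ≤ (M e^{10K²} B)^{1/2}/(log y)^n` from `E(q) ≤ M/φ(q)` and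
  `∑_{q ≤ Q} E(q) ≤ B/(log y)^{2n + 2K²}` (`∑_{q ≤ Q} K^{2ω(q)}/φ(q) ≤ e^{2K²(∑_{p ≤ Q} 1/p + 1)}`,
  `sum_pow_omega_div_totient_le`, and Mertens).
-/

noncomputable section

open Finset
open scoped BigOperators ArithmeticFunction.Omega ArithmeticFunction.omega
open Literature.NumberTheory.Sieve

namespace Summit.Parity.BatemanHorn.Cruxes.OddSectorShareLinear.Birth

namespace SieveDecouplingOdd

/-! ### The trivial bound for a class discrepancy -/

/-- `#{1 ≤ b ≤ y : b ≡ a (q)} ≤ y/q + 2` for `q ≥ 1` (`Nat.count_modEq_card`). [folklore] -/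
theorem card_Icc_filter_modEq_le {q : ℕ} (hq : 0 < q) (a y : ℕ) :
    (#((Icc 1 y).filter (fun b : ℕ => b ≡ a [MOD q])) : ℝ) ≤ (y : ℝ) / q + 2 := by
  have h1 : #((Icc 1 y).filter (fun b : ℕ => b ≡ a [MOD q])) ≤
      #((range (y + 1)).filter (fun b : ℕ => b ≡ a [MOD q])) :=
    card_le_card fun b hb => by
      rw [mem_filter, mem_Icc] at hb
      rw [mem_filter, mem_range]
      exact ⟨by omega, hb.2⟩
  have h2 : #((range (y + 1)).filter (fun b : ℕ => b ≡ a [MOD q])) ≤ (y + 1) / q + 1 := by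
    rw [← Nat.count_eq_card_filter_range, Nat.count_modEq_card _ hq]
    split_ifs <;> omega
  have h3 : (y + 1) / q ≤ y / q + 1 := by
    calc (y + 1) / q ≤ (y + q) / q := Nat.div_le_div_right (by omega)
      _ = y / q + 1 := Nat.add_div_right y hq
  have h4 : ((y / q : ℕ) : ℝ) ≤ (y : ℝ) / q := Nat.cast_div_le
  calc (#((Icc 1 y).filter (fun b : ℕ => b ≡ a [MOD q])) : ℝ) ≤ ((y / q + 2 : ℕ) : ℝ) := by
        exact_mod_cast h1.trans (h2.trans (by omega))
    _ ≤ (y : ℝ) / q + 2 := by push_cast; linarith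

/-- **The trivial bound** `|#{b ∈ roughIcc z y : Ω b = j+1, b ≡ a (q)} − #{… (b,q)=1}/φ(q)| ≤ 4y/φ(q)`
for `1 ≤ q ≤ y` (both counts are counts of integers `≤ y`, the first in one class). [folklore] -/
theorem abs_cell_disc_le {z y q j a : ℕ} (hq : 0 < q) (hqy : q ≤ y) :
    |(#((roughIcc z y).filter (fun b : ℕ => Ω b = j + 1 ∧ b ≡ a [MOD q])) : ℝ) -
        (#((roughIcc z y).filter (fun b : ℕ => Ω b = j + 1 ∧ b.Coprime q)) : ℝ) /
          Nat.totient q| ≤ 4 * y / Nat.totient q := by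
  have hφpos : (0 : ℝ) < Nat.totient q := by exact_mod_cast Nat.totient_pos.mpr hq
  have hφq : (Nat.totient q : ℝ) ≤ q := by exact_mod_cast Nat.totient_le q
  have hqy' : (q : ℝ) ≤ y := by exact_mod_cast hqy
  have hq0 : (0 : ℝ) < q := by exact_mod_cast hq
  have hA : (#((roughIcc z y).filter (fun b : ℕ => Ω b = j + 1 ∧ b ≡ a [MOD q])) : ℝ) ≤
      (y : ℝ) / q + 2 := by
    refine le_trans ?_ (card_Icc_filter_modEq_le hq a y)
    exact_mod_cast card_le_card fun b hb => by
      rw [mem_filter] at hb ⊢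
      exact ⟨roughIcc_subset_Icc z y hb.1, hb.2.2⟩
  have hB : (#((roughIcc z y).filter (fun b : ℕ => Ω b = j + 1 ∧ b.Coprime q)) : ℝ) ≤ y := by
    have h1 : #((roughIcc z y).filter (fun b : ℕ => Ω b = j + 1 ∧ b.Coprime q)) ≤ #(Icc 1 y) :=
      card_le_card ((filter_subset _ _).trans (roughIcc_subset_Icc z y))
    rw [Nat.card_Icc, Nat.add_sub_cancel] at h1
    exact_mod_cast h1
  have hyq : (y : ℝ) / q ≤ y / Nat.totient q := div_le_div_of_nonneg_left (Nat.cast_nonneg _) hφpos hφq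
  have h1 : 1 ≤ (y : ℝ) / Nat.totient q := by rw [le_div_iff₀ hφpos]; linarith
  have hB0 : (0 : ℝ) ≤ (#((roughIcc z y).filter (fun b : ℕ => Ω b = j + 1 ∧ b.Coprime q)) : ℝ) /
      Nat.totient q := by positivity
  have hB1 : (#((roughIcc z y).filter (fun b : ℕ => Ω b = j + 1 ∧ b.Coprime q)) : ℝ) /
      Nat.totient q ≤ y / Nat.totient q := div_le_div_of_nonneg_right hB hφpos.le
  have hA0 : (0 : ℝ) ≤ #((roughIcc z y).filter (fun b : ℕ => Ω b = j + 1 ∧ b ≡ a [MOD q])) :=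
    Nat.cast_nonneg _
  have h4 : 4 * (y : ℝ) / Nat.totient q = 4 * (y / Nat.totient q) := by ring
  rw [h4, abs_le]
  constructor <;> linarith

/-! ### A worst reduced class per modulus -/

/-- For `q ≥ 1` and a `q`-periodic `G`, some reduced class `c` maximises `G` over the reduced
classes. [folklore] -/
theorem exists_worst_class {q : ℕ} (hq : 0 < q) (G : ℕ → ℝ) (hG : ∀ a, G a = G (a % q)) :
    ∃ c : ℕ, c.Coprime q ∧ ∀ a : ℕ, a.Coprime q → G a ≤ G c := by
  have hmod : ∀ a : ℕ, Nat.Coprime (a % q) q ↔ Nat.Coprime a q := fun a => by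
    unfold Nat.Coprime
    rw [← Nat.gcd_rec, Nat.gcd_comm]
  have hne : ((range q).filter (fun a => a.Coprime q)).Nonempty :=
    ⟨1 % q, mem_filter.mpr ⟨mem_range.mpr (Nat.mod_lt 1 hq), (hmod 1).mpr (Nat.coprime_one_left q)⟩⟩
  obtain ⟨c, hc, hmax⟩ := exists_max_image _ G hne
  refine ⟨c, (mem_filter.mp hc).2, fun a ha => ?_⟩
  rw [hG a]
  exact hmax _ (mem_filter.mpr ⟨mem_range.mpr (Nat.mod_lt a hq), (hmod a).mpr ha⟩)

/-! ### The odd discrepancy is at most the sum of the cell discrepancies -/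

/-- If `Ω ≤ J` on `R`, then for any two conditions `P, Q` and `φ`:
`|#{b ∈ R : Ω b odd, P b} − #{b ∈ R : Ω b odd, Q b}/φ| ≤ ∑_{j < J even} |#{Ω b = j+1, P b} − #{Ω b = j+1, Q b}/φ|`
(`OneFormShare.card_filter_odd_eq_sum`). [folklore] -/
theorem abs_odd_disc_le_sum {R : Finset ℕ} {J : ℕ} (hJ : ∀ b ∈ R, Ω b ≤ J) (P Q : ℕ → Prop)
    [DecidablePred P] [DecidablePred Q] (φ : ℝ) :
    |(#(R.filter (fun b => Odd (Ω b) ∧ P b)) : ℝ) - (#(R.filter (fun b => Odd (Ω b) ∧ Q b)) : ℝ) / φ| ≤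
      ∑ j ∈ (range J).filter Even, |(#(R.filter (fun b => Ω b = j + 1 ∧ P b)) : ℝ) -
        (#(R.filter (fun b => Ω b = j + 1 ∧ Q b)) : ℝ) / φ| := by
  have hsplit : ∀ (T : ℕ → Prop) [DecidablePred T], (#(R.filter (fun b => Odd (Ω b) ∧ T b)) : ℝ) =
      ∑ j ∈ (range J).filter Even, (#(R.filter (fun b => Ω b = j + 1 ∧ T b)) : ℝ) := by
    intro T _
    have h := OneFormShare.card_filter_odd_eq_sum (R.filter T) (fun b => Ω b)
      (fun b hb => hJ b (mem_filter.mp hb).1)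
    simp only [filter_filter] at h
    rw [filter_congr (fun b (_ : b ∈ R) => (and_comm : Odd (Ω b) ∧ T b ↔ T b ∧ Odd (Ω b))), h,
      Nat.cast_sum]
    refine sum_congr rfl fun j _ => ?_
    rw [filter_congr (fun b (_ : b ∈ R) => (and_comm : Ω b = j + 1 ∧ T b ↔ T b ∧ Ω b = j + 1))]
  rw [hsplit P, hsplit Q, sum_div, ← sum_sub_distrib]
  exact abs_sum_le_sum_abs _ _

/-! ### The majorant built from the worst classes -/

/-- **The majorant of the odd class discrepancies.**  Given, for every cell `Ω = j + 1` and every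
choice `c` of one reduced class per modulus, `∑_{q ≤ Q} |disc_j(q, c(q))| ≤ C y/(log y)^A`
(`C ≥ 0`, `Q ≤ y`), there is `E ≥ 0` with: `|disc_odd(q, a)| ≤ E(q)` for all reduced `a mod q`
(once `Ω ≤ J` on `roughIcc z y`), `E(q) ≤ 4Jy/φ(q)` for `1 ≤ q ≤ Q`, and
`∑_{q ≤ Q} E(q) ≤ J C y/(log y)^A` (`E(q) = ∑_{j < J even} |disc_j(q, c_j(q))|` with worst classes
`c_j(q)`). [folklore] -/
theorem exists_majorant {z y J Q : ℕ} {C A : ℝ} (hC : 0 ≤ C) (hy : 1 ≤ y) (hQy : Q ≤ y)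
    (hBV : ∀ (j : ℕ) (c : ℕ → ℕ), (∀ q : ℕ, 0 < q → (c q).Coprime q) →
      ∑ q ∈ Icc 1 Q, |(#((roughIcc z y).filter (fun b : ℕ => Ω b = j + 1 ∧ b ≡ c q [MOD q])) : ℝ) -
        (#((roughIcc z y).filter (fun b : ℕ => Ω b = j + 1 ∧ b.Coprime q)) : ℝ) / Nat.totient q| ≤
          C * y / Real.log y ^ A) :
    ∃ E : ℕ → ℝ, (∀ q, 0 ≤ E q) ∧
      (∀ q a : ℕ, 0 < q → a.Coprime q → (∀ b ∈ roughIcc z y, Ω b ≤ J) →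
        |(#((roughIcc z y).filter (fun b : ℕ => Odd (Ω b) ∧ b ≡ a [MOD q])) : ℝ) -
          (#((roughIcc z y).filter (fun b : ℕ => Odd (Ω b) ∧ b.Coprime q)) : ℝ) / Nat.totient q| ≤
            E q) ∧
      (∀ q ∈ Icc 1 Q, E q ≤ 4 * J * y / Nat.totient q) ∧
      ∑ q ∈ Icc 1 Q, E q ≤ J * (C * y / Real.log y ^ A) := by
  -- the cell discrepancies and the worst classes
  obtain ⟨G, hG⟩ : ∃ G : ℕ → ℕ → ℕ → ℝ, ∀ j q a, G j q a =
      |(#((roughIcc z y).filter (fun b : ℕ => Ω b = j + 1 ∧ b ≡ a [MOD q])) : ℝ) -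
        (#((roughIcc z y).filter (fun b : ℕ => Ω b = j + 1 ∧ b.Coprime q)) : ℝ) / Nat.totient q| :=
    ⟨_, fun _ _ _ => rfl⟩
  have hG0 : ∀ j q a, 0 ≤ G j q a := fun j q a => by rw [hG]; exact abs_nonneg _
  have hGmod : ∀ j q a, G j q a = G j q (a % q) := fun j q a => by
    simp only [hG, Nat.ModEq, Nat.mod_mod]
  have hwc : ∀ j q : ℕ, ∃ c : ℕ, 0 < q → (c.Coprime q ∧ ∀ a : ℕ, a.Coprime q → G j q a ≤ G j q c) := by
    intro j q
    by_cases hq : 0 < q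
    · obtain ⟨c, hc⟩ := exists_worst_class hq (G j q) (hGmod j q)
      exact ⟨c, fun _ => hc⟩
    · exact ⟨0, fun h => absurd h hq⟩
  choose c hc using hwc
  refine ⟨fun q => ∑ j ∈ (range J).filter Even, G j q (c j q), fun q => sum_nonneg fun j _ => hG0 _ _ _,
    fun q a hq ha hJ => ?_, fun q hq => ?_, ?_⟩
  · -- majorant
    refine (abs_odd_disc_le_sum hJ (fun b => b ≡ a [MOD q]) (fun b => b.Coprime q) _).trans
      (sum_le_sum fun j _ => ?_)
    rw [← hG]
    exact ((hc j q) hq).2 a ha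
  · -- trivial bound
    obtain ⟨hq1, hqQ⟩ := mem_Icc.mp hq
    have hJ' : (#((range J).filter Even) : ℝ) ≤ J := by
      exact_mod_cast (card_filter_le _ _).trans (card_range J).le
    have ht : 0 ≤ 4 * (y : ℝ) / Nat.totient q := by positivity
    calc ∑ j ∈ (range J).filter Even, G j q (c j q)
        ≤ ∑ j ∈ (range J).filter Even, 4 * (y : ℝ) / Nat.totient q :=
          sum_le_sum fun j _ => by rw [hG]; exact abs_cell_disc_le hq1 (hqQ.trans hQy)
      _ = #((range J).filter Even) * (4 * (y : ℝ) / Nat.totient q) := by rw [sum_const, nsmul_eq_mul]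
      _ ≤ J * (4 * (y : ℝ) / Nat.totient q) := mul_le_mul_of_nonneg_right hJ' ht
      _ = 4 * J * y / Nat.totient q := by ring
  · -- the sum over the moduli
    rw [sum_comm]
    have hJ' : (#((range J).filter Even) : ℝ) ≤ J := by
      exact_mod_cast (card_filter_le _ _).trans (card_range J).le
    have hy0 : (0 : ℝ) ≤ Real.log y := Real.log_nonneg (by exact_mod_cast hy)
    have ht : 0 ≤ C * y / Real.log y ^ A := by positivity
    calc ∑ j ∈ (range J).filter Even, ∑ q ∈ Icc 1 Q, G j q (c j q)
        ≤ ∑ j ∈ (range J).filter Even, C * y / Real.log y ^ A :=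
          sum_le_sum fun j _ => by
            simp only [hG]
            exact hBV j (c j) fun q hq => ((hc j q) hq).1
      _ = #((range J).filter Even) * (C * y / Real.log y ^ A) := by rw [sum_const, nsmul_eq_mul]
      _ ≤ J * (C * y / Real.log y ^ A) := mul_le_mul_of_nonneg_right hJ' ht

/-! ### Cauchy–Schwarz: the divisor-weighted bound -/

/-- **Divisor weights by Cauchy–Schwarz** (the step of Maynard 2015, Lemma 5.2, for an abstract
error `E ≥ 0`): if `E(q) ≤ M/φ(q)` for `1 ≤ q ≤ Q ≤ y` (`y ≥ 3`) and
`∑_{q ≤ Q} E(q) ≤ B/(log y)^{2n + 2K²}`, then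
`∑_{q ≤ Q} K^{ω(q)} E(q) ≤ (M e^{10K²} B)^{1/2}/(log y)^n`
(`(∑ K^ω E)² ≤ (∑ K^{2ω} E)(∑ E)`, `∑_{q ≤ Q} K^{2ω(q)}/φ(q) ≤ e^{2K²(log log y + 5)}`). [folklore] -/
theorem sum_pow_omega_mul_le {E : ℕ → ℝ} {Q n : ℕ} {y M B K : ℝ} (hK : 0 ≤ K) (hy : 3 ≤ y)
    (hQy : (Q : ℝ) ≤ y) (hE0 : ∀ q, 0 ≤ E q) (hM : 0 ≤ M) (hB0 : 0 ≤ B)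
    (hEM : ∀ q ∈ Icc 1 Q, E q ≤ M / Nat.totient q)
    (hB : ∑ q ∈ Icc 1 Q, E q ≤ B / Real.log y ^ (2 * (n : ℝ) + 2 * K ^ 2)) :
    ∑ q ∈ Icc 1 Q, K ^ ω q * E q ≤
      Real.sqrt (M * Real.exp (2 * K ^ 2 * 5) * B) / Real.log y ^ n := by
  -- adapted from `Literature.NumberTheory.Sieve.MaynardPrimesHaveLevel.isBigO_sum_pow_omega_mul`
  set c := K ^ 2 with hc
  have hc0 : 0 ≤ c := by positivity
  have hx0 : 0 < y := by linarith
  have hlog1 : 1 ≤ Real.log y := by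
    rw [Real.le_log_iff_exp_le hx0]
    have := Real.exp_one_lt_d9
    linarith
  have hlogpos : 0 < Real.log y := by linarith
  -- Cauchy–Schwarz
  have hCS : (∑ q ∈ Icc 1 Q, K ^ ω q * E q) ^ 2 ≤
      (∑ q ∈ Icc 1 Q, c ^ ω q * E q) * ∑ q ∈ Icc 1 Q, E q := by
    refine Finset.sum_sq_le_sum_mul_sum_of_sq_le_mul _ (fun q _ => mul_nonneg (pow_nonneg hc0 _) (hE0 q))
      (fun q _ => hE0 q) fun q _ => le_of_eq ?_
    rw [hc]; ring
  -- bound 1: `∑ c^ω E ≤ M e^{10c} (log y)^{2c}`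
  have hP : ∑ p ∈ Nat.primesLE Q, (1 : ℝ) / p ≤ Real.log (Real.log y) + 4 := by
    rcases le_or_gt 2 Q with hQ2 | hQ2
    · have hQpos : (0 : ℝ) < Q := by exact_mod_cast (show 0 < Q by omega)
      calc ∑ p ∈ Nat.primesLE Q, (1 : ℝ) / p ≤ Real.log (Real.log Q) + 4 :=
            Literature.NumberTheory.LFunctions.MertensBound.sum_inv_prime_le Q hQ2
        _ ≤ Real.log (Real.log y) + 4 := by
            have hlogQ : 0 < Real.log Q := Real.log_pos (by exact_mod_cast (show 1 < Q by omega))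
            gcongr
    · have hempty : Nat.primesLE Q = ∅ := by
        interval_cases Q
        · exact Nat.primesLE_zero
        · exact Nat.primesLE_one
      rw [hempty, Finset.sum_empty]
      have : 0 ≤ Real.log (Real.log y) := Real.log_nonneg hlog1
      linarith
  have hB1 : ∑ q ∈ Icc 1 Q, c ^ ω q * E q ≤ M * (Real.exp (2 * c * 5) * Real.log y ^ (2 * c)) := by
    calc ∑ q ∈ Icc 1 Q, c ^ ω q * E q
        ≤ ∑ q ∈ Icc 1 Q, c ^ ω q * (M / Nat.totient q) :=
          Finset.sum_le_sum fun q hq => mul_le_mul_of_nonneg_left (hEM q hq) (by positivity)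
      _ = M * ∑ q ∈ Icc 1 Q, c ^ ω q / (Nat.totient q : ℝ) := by
          rw [Finset.mul_sum]
          refine Finset.sum_congr rfl fun q _ => by ring
      _ ≤ M * Real.exp (2 * c * (∑ p ∈ Nat.primesLE Q, (1 : ℝ) / p + 1)) := by
          gcongr
          exact sum_pow_omega_div_totient_le hc0 Q
      _ ≤ M * Real.exp (2 * c * (Real.log (Real.log y) + 5)) := by
          gcongr M * Real.exp (2 * c * ?_)
          linarith
      _ = M * (Real.exp (2 * c * 5) * Real.log y ^ (2 * c)) := by
          rw [show 2 * c * (Real.log (Real.log y) + 5) = 2 * c * 5 + Real.log (Real.log y) * (2 * c) by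
            ring, Real.exp_add, Real.rpow_def_of_pos hlogpos]
  -- combine
  have hS0 : 0 ≤ ∑ q ∈ Icc 1 Q, K ^ ω q * E q :=
    Finset.sum_nonneg fun q _ => mul_nonneg (pow_nonneg hK _) (hE0 q)
  have hL1 : Real.log y ^ (2 * (n : ℝ) + 2 * c) = Real.log y ^ (2 * (n : ℝ)) * Real.log y ^ (2 * c) :=
    Real.rpow_add hlogpos _ _
  have hL2 : (Real.log y ^ n) ^ 2 = Real.log y ^ (2 * (n : ℝ)) := by
    rw [← Real.rpow_natCast, ← Real.rpow_natCast, ← Real.rpow_mul hlogpos.le]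
    congr 1
    push_cast
    ring
  have hLc : 0 < Real.log y ^ (2 * c) := Real.rpow_pos_of_pos hlogpos _
  have hLn : 0 < Real.log y ^ n := pow_pos hlogpos n
  have hprod : (∑ q ∈ Icc 1 Q, K ^ ω q * E q) ^ 2 ≤
      (M * Real.exp (2 * c * 5) * B) / (Real.log y ^ n) ^ 2 := by
    calc (∑ q ∈ Icc 1 Q, K ^ ω q * E q) ^ 2
        ≤ (∑ q ∈ Icc 1 Q, c ^ ω q * E q) * ∑ q ∈ Icc 1 Q, E q := hCS
      _ ≤ (M * (Real.exp (2 * c * 5) * Real.log y ^ (2 * c))) *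
            (B / Real.log y ^ (2 * (n : ℝ) + 2 * c)) :=
          mul_le_mul hB1 hB (Finset.sum_nonneg fun q _ => hE0 q)
            (mul_nonneg hM (mul_nonneg (Real.exp_pos _).le hLc.le))
      _ = (M * Real.exp (2 * c * 5) * B) / (Real.log y ^ n) ^ 2 := by
          rw [hL2, hL1]
          field_simp
  have hR0 : 0 ≤ Real.sqrt (M * Real.exp (2 * c * 5) * B) / Real.log y ^ n := by positivity
  rw [← Real.sqrt_sq hS0, ← Real.sqrt_sq hR0]
  refine Real.sqrt_le_sqrt (hprod.trans (le_of_eq ?_))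
  rw [div_pow, Real.sq_sqrt (by positivity)]

end SieveDecouplingOdd

/-- **Sub-goal (divisor weights by Cauchy–Schwarz)** of the stub `stub_sieveDecouplingOdd_of_roughCellsBV`
(crux stmt-Parity-15629, line `birth`): an abstract error `E ≥ 0` with `E(q) ≤ M/φ(q)` (`q ≤ Q ≤ y`)
and `∑_{q ≤ Q} E(q) ≤ B/(log y)^{2n+2K²}` has `∑_{q ≤ Q} K^{ω(q)} E(q) ≤ (M e^{10K²} B)^{1/2}/(log y)^n`
(`SieveDecouplingOdd.sum_pow_omega_mul_le`). [folklore] -/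
theorem stub_decouplingOddWeightedLevel :
    ∀ (E : ℕ → ℝ) (Q n : ℕ) (y M B K : ℝ), 0 ≤ K → 3 ≤ y → (Q : ℝ) ≤ y → (∀ q, 0 ≤ E q) → 0 ≤ M → 0
    ≤ B → (∀ q ∈ Finset.Icc 1 Q, E q ≤ M / ((Nat.totient q : ℕ) : ℝ)) → ∑ q ∈ Finset.Icc 1 Q, E q ≤
    B / Real.log y ^ (2 * (n : ℝ) + 2 * K ^ 2) → ∑ q ∈ Finset.Icc 1 Q, K ^
    (ArithmeticFunction.cardDistinctFactors q) * E q ≤ Real.sqrt (M * Real.exp (2 * K ^ 2 * 5) * B)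
    / Real.log y ^ n
 :=
  fun _ _ _ _ _ _ _ hK hy hQy hE0 hM hB0 hEM hB =>
    SieveDecouplingOdd.sum_pow_omega_mul_le hK hy hQy hE0 hM hB0 hEM hB

end Summit.Parity.BatemanHorn.Cruxes.OddSectorShareLinear.Birth

end
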